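import Summits.RiemannHypothesis.RiemannHypothesis.Theorems.Splittings.JensenDerivativeLaguerre
import Literature.NumberTheory.LFunctions.XiJensenRows
import Literature.NumberTheory.LFunctions.JensenDegreeDescent
import HarnessLib

/-!
# Cell `rh-split`, seat `rh-split-x-wuc` gen 3 — the DERIVATIVE-ORDER LADDER of X-4
# (`RH ⟺ XiRowHyperbolic K ∧ ⋀_{k<K} RowSignLaw k` for EVERY `K`; `K = 1` is X-4; `K = ∞` degenerates)

HONEST LABEL: «SPLITTING SEARCH over kernel-typed RH-EQUIVALENCES; a splitting A ∧ B ⟹ RH is CONDITIONAL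
bookkeeping unless A and B are both proved; nothing here bears on the truth of RH.»

Scratch of card `cards/SPLIT-x-wuc.md` §9 (gen-3 addendum).  With `γ = xiTaylorCoeff` (`γ > 0`),
`J^{d,n}_γ = jensenPoly xiTaylorCoeff d n`, `G = xiSq` (`8ξ(½+z) = Σ γ(n) z^{2n}/(2n)!`, `G⁽ⁿ⁾` ↔ row `n`
by the tree's `xiRowHyperbolic_iff_xiDerivZerosReal`):

* `A_K := XiRowHyperbolic K` (tree def: every `J^{d,K}_γ` hyperbolic ⟺ `G⁽ᴷ⁾` has only real zeros ⟺
  GORTTW's `RH_K` region «rows `n ≥ K`» by `xiRowHyperbolic_mono`); `A_1` = X-4's A (`RowsFromOne`),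
  `A_0 ⟺ RH` (`riemannHypothesis_iff_xiRowHyperbolic_zero`);
* `B_k` (prose shorthand only; SPELLED OUT in every statement below — no definition in this file) —
  X-4's strict Laguerre SIGN LAW moved from row `0` to row `k`: at every real critical point `x` of
  `J^{d,k}_γ` (`d ≥ 2`) off its zeros, `J^{d,k}_γ(x) · (J^{d,k}_γ)″(x) < 0`, i.e.
  `∀ d ≥ 2, ∀ x, (J^{d,k}_γ)′(x) = 0 → J^{d,k}_γ(x) ≠ 0 → J^{d,k}_γ(x) · (J^{d,k}_γ)″(x) < 0`.

Proved (no `sorry`; RH-free except where RH is a hypothesis or conclusion):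
* `rowSignLaw_of_xiRowHyperbolic` (`A_k → B_k`), `rowSignLaw_of_rh`;
* `xiRowHyperbolic_of_succ_of_rowSignLaw` — ONE RUNG: `A_{k+1} ∧ B_k → A_k` (shift rule + `JointPoly`);
* `rh_iff_xiRowHyperbolic_and_signLawBelow K : RH ↔ A_K ∧ ∀ k < K, B_k` — the LADDER (both binders
  consumed for `K ≥ 1`; `K = 1` recovers X-4 via `rowsFromOne_iff_xiRowHyperbolic_one`);
  `rh_iff_xiDerivZerosReal_and_signLawBelow K` — the same with `A_K` read as «`G⁽ᴷ⁾ ∈ 𝓛𝓟`»;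
* `rh_iff_allRowSignLaw : RH ↔ ∀ k, B_k` — the `K = ∞` ENDPOINT: the sign law on ALL rows is
  RH-EQUIVALENT BY ITSELF (anti-diagonal climb from degree `≤ 1`; the tree's
  `JensenLaguerreFlow.riemannHypothesis_of_xi_flowInvariant` is the simple-zeros form of the same fact),
  hence `rh_iff_eventuallyRowHyperbolic_and_allRowSignLaw` — the «envelope» split
  `RH ↔ (∃ K, A_K) ∧ (∀ k, B_k)` is DEGENERATE (its B-conjunct alone is RH; `∃ K, A_K` idle).

* `splits_of_signLawBelow` — what `B_{<K}` ALONE certifies: exactly the triangle `d + n ≤ K + 1`;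
* §5 `cellSignLaw_iff_splits_of_shift_splits` / `rowSignLaw_iff_xiRowHyperbolic_of_succ` — the CELLWISE
  costume lemma: GIVEN `A_{k+1}`, `B_k ⟺ A_k` (row-`k` form of jen-neg g3's mask lemma at row `0`);
* §6 `xiRowHyperbolic_of_unbounded` / `rh_iff_unboundedRow_and_signLawBelow` — no thinning on the A-side
  (degree descent, `JensenDegreeDescent.splits_jensenPoly_of_le`).

So the derivative axis interpolates between the two one-conjunct endpoints `RH ⟺ A_0` and `RH ⟺ B_∞`
through the family `RH ⟺ A_K ∧ B_{<K}` (`1 ≤ K < ∞`), `A_K` weakening and `B_{<K}` strengthening in `K`.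
Every lemma of the DESCENT direction (`B`-side ⟹ hyperbolicity) is generic in `γ : ℕ → ℝ` (`JointPoly` +
shift rule only); the ascent directions use `γ k ≠ 0` (`xiTaylorCoeff_pos`) for `natDegree J^{d,k} = d`.
Model non-degeneracy of each finite rung, labels and locators: the card.  Not a claim about RH.
-/

noncomputable section

set_option linter.dupNamespace false

open Polynomial
open Literature.NumberTheory.LFunctions Literature.Barriers.RiemannHypothesis Literature.Analysis.Complex
open Summit.RiemannHypothesis.RiemannHypothesis.Theorems.Splittings.JensenDerivativeLaguerre
  (laguerre_strict_of_splits)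

namespace Summit.RiemannHypothesis.RiemannHypothesis.Theorems.Splittings.JensenDerivativeLadder

/-! ## §1 Each `B_k` is implied by `A_k` (hence by RH) — the strict Laguerre inequality -/

/-- `A_k → B_k`: if row `k` is hyperbolic then the strict sign law holds on row `k` (strict Laguerre
inequality `J′² − J J″ > 0` off the zeros of a real-rooted `J` of degree `d ≥ 1`, at a critical point).
RH-free. [cite: CravenCsordas1989, §1 (the Laguerre inequality)] -/
theorem rowSignLaw_of_xiRowHyperbolic {k : ℕ} (h : XiRowHyperbolic k) :
    (∀ d : ℕ, 2 ≤ d → ∀ x : ℝ, (derivative (jensenPoly xiTaylorCoeff d k)).eval x = 0 →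
      (jensenPoly xiTaylorCoeff d k).eval x ≠ 0 →
      (jensenPoly xiTaylorCoeff d k).eval x *
        (derivative (derivative (jensenPoly xiTaylorCoeff d k))).eval x < 0) := by
  intro d hd x hcrit hne
  have hdeg : (jensenPoly xiTaylorCoeff d k).natDegree = d :=
    natDegree_jensenPoly xiTaylorCoeff d k (xiTaylorCoeff_pos_holds _).ne'
  have hl := laguerre_strict_of_splits (h d) (by omega) hne
  rw [hcrit] at hl
  nlinarith [hl]

/-- `RH → B_k` for every row `k`. [cite: GORZPNAS2019, §1] -/
theorem rowSignLaw_of_rh (hRH : _root_.RiemannHypothesis) (k : ℕ) :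
    (∀ d : ℕ, 2 ≤ d → ∀ x : ℝ, (derivative (jensenPoly xiTaylorCoeff d k)).eval x = 0 →
      (jensenPoly xiTaylorCoeff d k).eval x ≠ 0 →
      (jensenPoly xiTaylorCoeff d k).eval x *
        (derivative (derivative (jensenPoly xiTaylorCoeff d k))).eval x < 0) :=
  rowSignLaw_of_xiRowHyperbolic (xiRowHyperbolic_of_riemannHypothesis hRH k)

/-! ## §2 One rung: `A_{k+1} ∧ B_k → A_k` -/

/-- **One rung of the ladder** (X-4's mechanism on row `k`): if row `k+1` is hyperbolic and the strict
sign law holds on row `k`, then row `k` is hyperbolic — degree `d ≥ 2` from `(J^{d,k})′ = d·J^{d-1,k+1}`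
(`JensenLaguerreFlow.derivative_jensenPoly_succ`) and the RH-free glue
`JointPoly.splits_of_derivative_splits_of_laguerre`; degrees `≤ 1` split trivially.  RH-free.
[cite: CravenCsordas1989, §2 (g′_{n,p} = n g_{n−1,p+1})] -/
theorem xiRowHyperbolic_of_succ_of_rowSignLaw {k : ℕ} (hA : XiRowHyperbolic (k + 1))
    (hB : (∀ d : ℕ, 2 ≤ d → ∀ x : ℝ, (derivative (jensenPoly xiTaylorCoeff d k)).eval x = 0 →
          (jensenPoly xiTaylorCoeff d k).eval x ≠ 0 →
          (jensenPoly xiTaylorCoeff d k).eval x *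
            (derivative (derivative (jensenPoly xiTaylorCoeff d k))).eval x < 0)) : XiRowHyperbolic k := by
  intro d
  rcases Nat.lt_or_ge d 2 with hd | hd
  · exact Splits.of_natDegree_le_one ((Literature.NumberTheory.LFunctions.natDegree_jensenPoly_le _ d k).trans (by omega))
  · obtain ⟨e, rfl⟩ := Nat.exists_eq_add_of_le' hd
    refine JointPoly.splits_of_derivative_splits_of_laguerre _ ?_ (hB _ hd)
    rw [JensenLaguerreFlow.derivative_jensenPoly_succ]
    exact (hA (e + 1)).C_mul _

/-! ## §3 The ladder `RH ⟺ A_K ∧ ⋀_{k<K} B_k`, every `K` -/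

/-- Descending the ladder: `A_K` and the sign laws on rows `0, …, K−1` give row `0`. RH-free. -/
theorem xiRowHyperbolic_zero_of_signLawBelow {K : ℕ} (hA : XiRowHyperbolic K)
    (hB : ∀ k : ℕ, k < K →
        (∀ d : ℕ, 2 ≤ d → ∀ x : ℝ, (derivative (jensenPoly xiTaylorCoeff d k)).eval x = 0 →
          (jensenPoly xiTaylorCoeff d k).eval x ≠ 0 →
          (jensenPoly xiTaylorCoeff d k).eval x *
            (derivative (derivative (jensenPoly xiTaylorCoeff d k))).eval x < 0)) : XiRowHyperbolic 0 := by
  induction K with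
  | zero => exact hA
  | succ K ih =>
    exact ih (xiRowHyperbolic_of_succ_of_rowSignLaw hA (hB K K.lt_succ_self))
      (fun k hk => hB k (Nat.lt_succ_of_lt hk))

/-- `A_K ∧ B_{<K} ⟹ RH` (row `0` hyperbolic is RH, `riemannHypothesis_iff_xiRowHyperbolic_zero`).  For
`K ≥ 1` BOTH hypotheses are consumed.  CONDITIONAL bookkeeping (A_K, B_k open); not a claim about RH.
[cite: GORZPNAS2019, Theorem 1 (RH ⇔ hyperbolicity of all J^{d,n}_γ; Pólya 1927)] -/
theorem rh_of_xiRowHyperbolic_of_signLawBelow {K : ℕ} (hA : XiRowHyperbolic K)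
    (hB : ∀ k : ℕ, k < K →
        (∀ d : ℕ, 2 ≤ d → ∀ x : ℝ, (derivative (jensenPoly xiTaylorCoeff d k)).eval x = 0 →
          (jensenPoly xiTaylorCoeff d k).eval x ≠ 0 →
          (jensenPoly xiTaylorCoeff d k).eval x *
            (derivative (derivative (jensenPoly xiTaylorCoeff d k))).eval x < 0)) : _root_.RiemannHypothesis :=
  riemannHypothesis_iff_xiRowHyperbolic_zero.2 (xiRowHyperbolic_zero_of_signLawBelow hA hB)

/-- **THE LADDER (kernel equivalence, every `K`).** `RH ⟺ A_K ∧ ⋀_{k<K} B_k`: `K = 0` is Pólya's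
criterion (`B`-side empty), `K = 1` is X-4, and for each `K ≥ 1` both conjuncts are RH-IMPLIED and OPEN.
CLASS-(a)-shape VARIANTS of X-4; verdict UNDECIDED for each `K`; nothing here bears on the truth of RH.
[cite: GORZPNAS2019, Theorem 1] -/
theorem rh_iff_xiRowHyperbolic_and_signLawBelow (K : ℕ) :
    _root_.RiemannHypothesis ↔ XiRowHyperbolic K ∧ ∀ k : ℕ, k < K →
        (∀ d : ℕ, 2 ≤ d → ∀ x : ℝ, (derivative (jensenPoly xiTaylorCoeff d k)).eval x = 0 →
          (jensenPoly xiTaylorCoeff d k).eval x ≠ 0 →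
          (jensenPoly xiTaylorCoeff d k).eval x *
            (derivative (derivative (jensenPoly xiTaylorCoeff d k))).eval x < 0) :=
  ⟨fun h => ⟨xiRowHyperbolic_of_riemannHypothesis h K, fun k _ => rowSignLaw_of_rh h k⟩,
    fun h => rh_of_xiRowHyperbolic_of_signLawBelow h.1 h.2⟩

/-- The ladder with `A_K` read as «`G⁽ᴷ⁾ = xiSq⁽ᴷ⁾` has only real zeros» (tree dictionary
`xiRowHyperbolic_iff_xiDerivZerosReal`): `RH ⟺ (ξ₁⁽ᴷ⁾ ∈ 𝓛𝓟) ∧ ⋀_{k<K} B_k`.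
[cite: CravenCsordas1989, §1 (i)] -/
theorem rh_iff_xiDerivZerosReal_and_signLawBelow (K : ℕ) :
    _root_.RiemannHypothesis ↔ XiDerivZerosReal K ∧ ∀ k : ℕ, k < K →
        (∀ d : ℕ, 2 ≤ d → ∀ x : ℝ, (derivative (jensenPoly xiTaylorCoeff d k)).eval x = 0 →
          (jensenPoly xiTaylorCoeff d k).eval x ≠ 0 →
          (jensenPoly xiTaylorCoeff d k).eval x *
            (derivative (derivative (jensenPoly xiTaylorCoeff d k))).eval x < 0) := by
  rw [← xiRowHyperbolic_iff_xiDerivZerosReal]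
  exact rh_iff_xiRowHyperbolic_and_signLawBelow K

/-- `K = 1` is X-4: X-4's A (`RowsFromOne`) is `A_1` (degree-free row monotonicity
`xiRowHyperbolic_mono`). RH-free. -/
theorem rowsFromOne_iff_xiRowHyperbolic_one :
    (∀ d n : ℕ, 1 ≤ n → (jensenPoly xiTaylorCoeff d n).Splits) ↔ XiRowHyperbolic 1 :=
  ⟨fun h d => h d 1 le_rfl, fun h d _n hn => xiRowHyperbolic_mono hn h d⟩

-- `K = 1` of the ladder is LITERALLY X-4: with `rowsFromOne_iff_xiRowHyperbolic_one` and
-- `Nat.lt_one_iff`, `rh_iff_xiRowHyperbolic_and_signLawBelow 1` is the landed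
-- `JensenDerivativeLaguerre.rh_iff_rowsFromOne_and_rowZeroLaguerre` (not restated here: dedup).

/-- The `A`-side weakens along the ladder: `A_K → A_{K'}` for `K ≤ K'` (tree `xiRowHyperbolic_mono`,
Rolle), so `A_K ⟺ «all rows n ≥ K hyperbolic»` = GORTTW's `RH_K` region. RH-free.
[cite: GriffinEtAl2022, §1 (definition of RH_m)] -/
theorem xiRowHyperbolic_iff_rowsFrom (K : ℕ) :
    XiRowHyperbolic K ↔ ∀ d n : ℕ, K ≤ n → (jensenPoly xiTaylorCoeff d n).Splits :=
  ⟨fun h d _n hn => xiRowHyperbolic_mono hn h d, fun h d => h d K le_rfl⟩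

/-! ## §4 The endpoint `K = ∞`: the sign law on ALL rows is RH-equivalent BY ITSELF -/

/-- Anti-diagonal climb: the sign laws on ALL rows make EVERY `J^{d,n}_γ` hyperbolic — induction on
the degree `d` from the trivially hyperbolic degrees `≤ 1`, each step `JointPoly` + shift rule (no
hyperbolic row is needed to start).  RH-free.  (The tree's
`JensenLaguerreFlow.splits_jensenPoly_of_flowInvariant` is the simple-zeros variant, via the
anti-diagonal Turán determinant.) [cite: CravenCsordas1989, §1 (i), §2] -/
theorem splits_of_allRowSignLaw (hB : ∀ k : ℕ,
    (∀ d : ℕ, 2 ≤ d → ∀ x : ℝ, (derivative (jensenPoly xiTaylorCoeff d k)).eval x = 0 →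
      (jensenPoly xiTaylorCoeff d k).eval x ≠ 0 →
      (jensenPoly xiTaylorCoeff d k).eval x *
        (derivative (derivative (jensenPoly xiTaylorCoeff d k))).eval x < 0)) :
    ∀ d n : ℕ, (jensenPoly xiTaylorCoeff d n).Splits := by
  intro d
  induction d with
  | zero =>
    intro n
    exact Splits.of_natDegree_le_one ((Literature.NumberTheory.LFunctions.natDegree_jensenPoly_le _ 0 n).trans (by omega))
  | succ d ih =>
    intro n
    rcases Nat.lt_or_ge (d + 1) 2 with hd | hd
    · exact Splits.of_natDegree_le_one ((Literature.NumberTheory.LFunctions.natDegree_jensenPoly_le _ (d + 1) n).trans (by omega))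
    · refine JointPoly.splits_of_derivative_splits_of_laguerre _ ?_ (hB n _ hd)
      rw [JensenLaguerreFlow.derivative_jensenPoly_succ]
      exact (ih (n + 1)).C_mul _

/-- **`K = ∞` endpoint: `RH ⟺ ∀ k, B_k`** — the all-rows sign law ALONE is RH-EQUIVALENT (kernel).
RH-EQUIVALENT statement recorded as such; not a claim about RH. [cite: GORZPNAS2019, Theorem 1] -/
theorem rh_iff_allRowSignLaw : _root_.RiemannHypothesis ↔ ∀ k : ℕ,
    (∀ d : ℕ, 2 ≤ d → ∀ x : ℝ, (derivative (jensenPoly xiTaylorCoeff d k)).eval x = 0 →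
      (jensenPoly xiTaylorCoeff d k).eval x ≠ 0 →
      (jensenPoly xiTaylorCoeff d k).eval x *
        (derivative (derivative (jensenPoly xiTaylorCoeff d k))).eval x < 0) :=
  ⟨fun h k => rowSignLaw_of_rh h k,
    fun hB => riemannHypothesis_iff_xiRowHyperbolic_zero.2 fun d => splits_of_allRowSignLaw hB d 0⟩

/-- **The «envelope» split is DEGENERATE**: `RH ⟺ (∃ K, A_K) ∧ (∀ k, B_k)` holds, but its proof never
uses `∃ K, A_K` (the B-conjunct alone is RH by `rh_iff_allRowSignLaw`) — tautology test FAIL-shape for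
the limit of the ladder, recorded in kernel.  Not a claim about RH. [cite: GORZPNAS2019, Theorem 1] -/
theorem rh_iff_eventuallyRowHyperbolic_and_allRowSignLaw :
    _root_.RiemannHypothesis ↔ (∃ K : ℕ, XiRowHyperbolic K) ∧ ∀ k : ℕ,
        (∀ d : ℕ, 2 ≤ d → ∀ x : ℝ, (derivative (jensenPoly xiTaylorCoeff d k)).eval x = 0 →
          (jensenPoly xiTaylorCoeff d k).eval x ≠ 0 →
          (jensenPoly xiTaylorCoeff d k).eval x *
            (derivative (derivative (jensenPoly xiTaylorCoeff d k))).eval x < 0) :=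
  ⟨fun h => ⟨⟨0, xiRowHyperbolic_of_riemannHypothesis h 0⟩, fun k => rowSignLaw_of_rh h k⟩,
    fun h => rh_iff_allRowSignLaw.2 h.2⟩

/-- What `B_{<K}` ALONE buys (RH-free): the sign laws on rows `< K` make the TRIANGLE `d ≤ K + 1 − n`... more
precisely every `J^{d,n}_γ` with `d + n ≤ K + 1` hyperbolic (climb from degree `≤ 1` inside rows `< K`).
So no finite family of row sign laws reaches a full row. [folklore] -/
theorem splits_of_signLawBelow {K : ℕ} (hB : ∀ k : ℕ, k < K →
    (∀ d : ℕ, 2 ≤ d → ∀ x : ℝ, (derivative (jensenPoly xiTaylorCoeff d k)).eval x = 0 →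
      (jensenPoly xiTaylorCoeff d k).eval x ≠ 0 →
      (jensenPoly xiTaylorCoeff d k).eval x *
        (derivative (derivative (jensenPoly xiTaylorCoeff d k))).eval x < 0)) :
    ∀ d n : ℕ, d + n ≤ K + 1 → (jensenPoly xiTaylorCoeff d n).Splits := by
  intro d
  induction d with
  | zero =>
    intro n _
    exact Splits.of_natDegree_le_one ((Literature.NumberTheory.LFunctions.natDegree_jensenPoly_le _ 0 n).trans (by omega))
  | succ d ih =>
    intro n hdn
    rcases Nat.lt_or_ge (d + 1) 2 with hd | hd
    · exact Splits.of_natDegree_le_one ((Literature.NumberTheory.LFunctions.natDegree_jensenPoly_le _ (d + 1) n).trans (by omega))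
    · refine JointPoly.splits_of_derivative_splits_of_laguerre _ ?_ (hB n (by omega) _ hd)
      rw [JensenLaguerreFlow.derivative_jensenPoly_succ]
      exact (ih (n + 1) (by omega)).C_mul _

/-! ## §5 Cellwise: given the cell one step down the anti-diagonal, the sign law at a cell IS its hyperbolicity -/

/-- **Cellwise costume lemma.** If `J^{e+1,k+1}_γ` is hyperbolic, then at the cell `(e+2, k)` the
strict sign law holds iff `J^{e+2,k}_γ` is hyperbolic (`→`: `JointPoly` + shift rule; `←`: strict
Laguerre).  So GIVEN `A_{k+1}`, the conjunct `B_k` is row-`k` hyperbolicity cell by cell — and NOT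
otherwise (model witnesses with `B_0, …, B_{K-1}` true and rows `0, …, K` non-hyperbolic: card §9.3).
RH-free. [cite: CravenCsordas1989, §1 (the Laguerre inequality), §2] -/
theorem cellSignLaw_iff_splits_of_shift_splits {e k : ℕ}
    (hA : (jensenPoly xiTaylorCoeff (e + 1) (k + 1)).Splits) :
    (∀ x : ℝ, (derivative (jensenPoly xiTaylorCoeff (e + 2) k)).eval x = 0 →
        (jensenPoly xiTaylorCoeff (e + 2) k).eval x ≠ 0 →
        (jensenPoly xiTaylorCoeff (e + 2) k).eval x *
          (derivative (derivative (jensenPoly xiTaylorCoeff (e + 2) k))).eval x < 0) ↔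
      (jensenPoly xiTaylorCoeff (e + 2) k).Splits := by
  constructor
  · intro hB
    refine JointPoly.splits_of_derivative_splits_of_laguerre _ ?_ hB
    rw [JensenLaguerreFlow.derivative_jensenPoly_succ]
    exact hA.C_mul _
  · intro hs x hcrit hne
    have hdeg : (jensenPoly xiTaylorCoeff (e + 2) k).natDegree = e + 2 :=
      natDegree_jensenPoly xiTaylorCoeff (e + 2) k (xiTaylorCoeff_pos_holds _).ne'
    have hl := laguerre_strict_of_splits hs (by omega) hne
    rw [hcrit] at hl
    nlinarith [hl]

/-- Row form of the cellwise lemma: GIVEN `A_{k+1}`, `B_k ⟺ A_k` (so each rung `A_{k+1} ∧ B_k` is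
literally `A_{k+1} ∧ A_k ⟺ A_k`; the content of the ladder split at level `K` is that `B_{<K}` is
stated WITHOUT any hyperbolic row).  RH-free. [cite: CravenCsordas1989, §1, §2] -/
theorem rowSignLaw_iff_xiRowHyperbolic_of_succ {k : ℕ} (hA : XiRowHyperbolic (k + 1)) :
 (∀ d : ℕ, 2 ≤ d → ∀ x : ℝ, (derivative (jensenPoly xiTaylorCoeff d k)).eval x = 0 →
          (jensenPoly xiTaylorCoeff d k).eval x ≠ 0 →
          (jensenPoly xiTaylorCoeff d k).eval x *
            (derivative (derivative (jensenPoly xiTaylorCoeff d k))).eval x < 0) ↔ XiRowHyperbolic k :=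
  ⟨xiRowHyperbolic_of_succ_of_rowSignLaw hA, rowSignLaw_of_xiRowHyperbolic⟩

/-! ## §6 No thinning on the A-side: a row hyperbolic at infinitely many degrees is hyperbolic -/

/-- **Census V24 (kernel).** «Row `K` hyperbolic along an unbounded set of degrees» is NOT a weaker conjunct than
`A_K`: hyperbolicity descends to every lower degree (`splits_jensenPoly_of_le`, Craven–Csordas), so it IS `A_K`.
(Contrast jen-neg g3 (v): thinning the B-side to an unbounded degree set is possible GIVEN A.) RH-free.
[cite: CravenCsordas1989, §1 (i)] -/
theorem xiRowHyperbolic_of_unbounded {K : ℕ}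
    (h : ∀ D : ℕ, ∃ d : ℕ, D ≤ d ∧ (jensenPoly xiTaylorCoeff d K).Splits) : XiRowHyperbolic K := by
  intro d
  obtain ⟨d', hle, hs⟩ := h d
  exact Literature.NumberTheory.LFunctions.splits_jensenPoly_of_le hle hs

/-- Hence at every level `K` the A-conjunct cannot be thinned: `RH ⟺ (row K hyperbolic at infinitely many
degrees) ∧ B_{<K}` is the SAME split as `rh_iff_xiRowHyperbolic_and_signLawBelow K`. Hypothesis-free.
[cite: CravenCsordas1989, §1 (i)] -/
theorem rh_iff_unboundedRow_and_signLawBelow (K : ℕ) :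
    _root_.RiemannHypothesis ↔
      (∀ D : ℕ, ∃ d : ℕ, D ≤ d ∧ (jensenPoly xiTaylorCoeff d K).Splits) ∧ ∀ k : ℕ, k < K →
          (∀ d : ℕ, 2 ≤ d → ∀ x : ℝ, (derivative (jensenPoly xiTaylorCoeff d k)).eval x = 0 →
            (jensenPoly xiTaylorCoeff d k).eval x ≠ 0 →
            (jensenPoly xiTaylorCoeff d k).eval x *
              (derivative (derivative (jensenPoly xiTaylorCoeff d k))).eval x < 0) := by
  rw [rh_iff_xiRowHyperbolic_and_signLawBelow K]
  exact ⟨fun h ↦ ⟨fun D ↦ ⟨D, le_rfl, h.1 D⟩, h.2⟩, fun h ↦ ⟨xiRowHyperbolic_of_unbounded h.1, h.2⟩⟩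

end Summit.RiemannHypothesis.RiemannHypothesis.Theorems.Splittings.JensenDerivativeLadder

end
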